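import Summits.Ventures.LatticeQCDFlow.Exactness.ReversiblePositive
import Summits.Ventures.LatticeQCDFlow.Exactness.FlowSamplerLogConvex
import HarnessLib

/-!
# POSITIVE reversible exact samplers, normalised: `ρ(1)ᵏ ≤ ρ(k) ≤ 1`, every window is a floor of `τ_int`, and `τ_int ≥ ½` for every observable

HONEST FRAMING: exact (Metropolis-corrected) sampling algorithms for lattice gauge theory;
figures of merit are autocorrelation/cost numbers at stated couplings and volumes; no
continuum-physics claim.  (SCALAR calibration rung S0-A: not a gauge result.)

Venture `LatticeQCDFlow` (cell pub-lqcd), topic `Exactness`; FANOUT row 2 (`s0-phi4`).  NEW WORK of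
the cell: the `τ_int`-level consequences of `Exactness/ReversiblePositive.lean` (a reversible exact
sampler in the `RevOp` format which is POSITIVE on its admissible class, (pos) `0 ≤ ∫ f (K f) w`:
all autocovariances `a(k) = ∫ u (Kᵏ u) w` are `≥ 0`, nonincreasing, convex, log-convex), in the
cell's vocabulary `Scoring.tauInt` / `Scoring.tauIntWindow`, through the real-sequence lemmas of
`Exactness/FlowSamplerLogConvex.lean` (`logConvex_ratio_pow_le`, `tauIntWindow_le_tauInt_of_nonneg`,
`tauInt_ge_of_pow_le`).  Nothing is cited as a fact.  Printed counterparts NAMED ONLY: Geyer 1992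
(Statist. Sci. 7, §3.3: for positive — there "two-step" — chains the truncated autocovariance sums
increase to the limit); Sokal 1989/1997 lecture notes (windowing bias of `τ_int` estimators);
Rudolf–Ullrich 2013 (positivity ⇒ nonnegative spectrum).

## What is proved (namespace `RevOp`; `ρ(k) = a(k)/a(0)`, Lean's `x/0 = 0` covers `a(0) = 0`)

* `autocorr_nonneg_of_pos`, `autocorr_le_one_of_pos`, `autocorr_succ_le_of_pos` — `0 ≤ ρ(k+1) ≤ ρ(k) ≤ 1`;
* **`autocorr_pow_le_of_pos`** — `ρ(1)^k ≤ ρ(k)`: no positive sampler decorrelates ANY observable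
  faster than geometrically at that observable's own lag-one rate;
* **`tauIntWindow_mono_of_pos`**, **`tauIntWindow_le_tauInt_of_pos`** — the windows `τ_W = ½ +
  Σ_{k≤W} ρ(k)` increase with `W` and EVERY one of them is `≤ τ_int` (summable case): for positive
  samplers the truncation bias of a windowed `τ_int` is one-signed at every cut-off (for a general
  reversible sampler only odd cut-offs are safe — `Exactness/ReversiblePairSums.lean`);
* **`half_le_tauInt_of_pos`** — `½ ≤ ½ + ρ(1) ≤ τ_int`: a positive exact sampler is never better
  than independent draws from the target, for ANY observable of the class (no antithetic gain);
* **`tauInt_ge_geom_of_pos`** — summability alone forces `ρ(1) < 1` and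
  `τ_int ≥ (1 + ρ(1))/(2(1 − ρ(1)))` (the Madras–Slade floor without its `ρ(1) < 1` hypothesis);
* **`summable_autocorr_of_windows_le`** — windows bounded by `B` ⇒ the series is summable (then
  `τ_W ↑ τ_int ≤ B`): for a positive sampler "`τ_int = ∞`" and "the windows grow without bound" are
  the same statement, observable by observable.

NOT CLAIMED: (pos) for HMC or for uniform-window Metropolis steps; any decay rate; any number for
any run.
-/

namespace Summit.Ventures.LatticeQCDFlow.Exactness

open Real MeasureTheory Filter Finset
open Summit.Ventures.LatticeQCDFlow.Scoring

namespace RevOp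

variable {X : Type*} [MeasurableSpace X] {μ : Measure X} {w : X → ℝ} {A : (X → ℝ) → Prop}
  {K : (X → ℝ) → (X → ℝ)}

/-! ## §3 Normalised statements: `ρ(k) = a(k)/a(0)`, windows, `τ_int` -/

/-- `0 ≤ ρ(k)` for every lag. -/
theorem autocorr_nonneg_of_pos (hw0 : ∀ x, 0 ≤ w x)
    (hAK : ∀ ⦃f : X → ℝ⦄, A f → A (K f))
    (hsymm : ∀ ⦃f h : X → ℝ⦄, A f → A h →
      ∫ x, K f x * h x * w x ∂μ = ∫ x, f x * K h x * w x ∂μ)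
    (hpos : ∀ ⦃f : X → ℝ⦄, A f → 0 ≤ ∫ x, f x * K f x * w x ∂μ)
    {u : X → ℝ} (hu : A u) (k : ℕ) :
    0 ≤ (∫ x, u x * (K^[k] u) x * w x ∂μ) / ∫ x, u x ^ 2 * w x ∂μ :=
  div_nonneg (autocov_nonneg_of_pos hw0 hAK hsymm hpos hu k)
    (integral_nonneg fun x => mul_nonneg (sq_nonneg _) (hw0 x))

/-- `ρ(k) ≤ 1` for every lag. -/
theorem autocorr_le_one_of_pos (hw0 : ∀ x, 0 ≤ w x)
    (hAi : ∀ ⦃f h : X → ℝ⦄, A f → A h → Integrable (fun x => f x * h x * w x) μ)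
    (hAc : ∀ ⦃f h : X → ℝ⦄ (c : ℝ), A f → A h → A (fun x => f x + c * h x))
    (hAK : ∀ ⦃f : X → ℝ⦄, A f → A (K f))
    (hlin : ∀ ⦃f h : X → ℝ⦄ (c : ℝ), A f → A h →
      ∀ x, K (fun s => f s + c * h s) x = K f x + c * K h x)
    (hsymm : ∀ ⦃f h : X → ℝ⦄, A f → A h →
      ∫ x, K f x * h x * w x ∂μ = ∫ x, f x * K h x * w x ∂μ)
    (hcontr : ∀ ⦃f : X → ℝ⦄, A f → ∫ x, K f x ^ 2 * w x ∂μ ≤ ∫ x, f x ^ 2 * w x ∂μ)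
    (hpos : ∀ ⦃f : X → ℝ⦄, A f → 0 ≤ ∫ x, f x * K f x * w x ∂μ)
    {u : X → ℝ} (hu : A u) (k : ℕ) :
    (∫ x, u x * (K^[k] u) x * w x ∂μ) / (∫ x, u x ^ 2 * w x ∂μ) ≤ 1 := by
  have hP0 : 0 ≤ ∫ x, u x ^ 2 * w x ∂μ := integral_nonneg fun x => mul_nonneg (sq_nonneg _) (hw0 x)
  have h := autocov_le_sq_of_pos hw0 hAi hAc hAK hlin hsymm hcontr hpos hu k
  rcases eq_or_lt_of_le hP0 with hz | hp
  · rw [← hz, div_zero]; exact zero_le_one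
  · rwa [div_le_one hp]

/-- `ρ(k+1) ≤ ρ(k)`: the normalised autocorrelation function of a positive sampler is nonincreasing. -/
theorem autocorr_succ_le_of_pos (hw0 : ∀ x, 0 ≤ w x)
    (hAi : ∀ ⦃f h : X → ℝ⦄, A f → A h → Integrable (fun x => f x * h x * w x) μ)
    (hAc : ∀ ⦃f h : X → ℝ⦄ (c : ℝ), A f → A h → A (fun x => f x + c * h x))
    (hAK : ∀ ⦃f : X → ℝ⦄, A f → A (K f))
    (hlin : ∀ ⦃f h : X → ℝ⦄ (c : ℝ), A f → A h →
      ∀ x, K (fun s => f s + c * h s) x = K f x + c * K h x)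
    (hsymm : ∀ ⦃f h : X → ℝ⦄, A f → A h →
      ∫ x, K f x * h x * w x ∂μ = ∫ x, f x * K h x * w x ∂μ)
    (hcontr : ∀ ⦃f : X → ℝ⦄, A f → ∫ x, K f x ^ 2 * w x ∂μ ≤ ∫ x, f x ^ 2 * w x ∂μ)
    (hpos : ∀ ⦃f : X → ℝ⦄, A f → 0 ≤ ∫ x, f x * K f x * w x ∂μ)
    {u : X → ℝ} (hu : A u) (k : ℕ) :
    (∫ x, u x * (K^[k + 1] u) x * w x ∂μ) / (∫ x, u x ^ 2 * w x ∂μ)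
      ≤ (∫ x, u x * (K^[k] u) x * w x ∂μ) / ∫ x, u x ^ 2 * w x ∂μ :=
  div_le_div_of_nonneg_right (autocov_succ_le_of_pos hw0 hAi hAc hAK hlin hsymm hcontr hpos hu k)
    (integral_nonneg fun x => mul_nonneg (sq_nonneg _) (hw0 x))

/-- **No positive sampler decorrelates faster than geometrically at its lag-one rate**:
`ρ(1)^(k+1) ≤ ρ(k+1)` (log-convexity and nonnegativity). -/
theorem autocorr_pow_le_of_pos (hw0 : ∀ x, 0 ≤ w x)
    (hAi : ∀ ⦃f h : X → ℝ⦄, A f → A h → Integrable (fun x => f x * h x * w x) μ)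
    (hAc : ∀ ⦃f h : X → ℝ⦄ (c : ℝ), A f → A h → A (fun x => f x + c * h x))
    (hAK : ∀ ⦃f : X → ℝ⦄, A f → A (K f))
    (hlin : ∀ ⦃f h : X → ℝ⦄ (c : ℝ), A f → A h →
      ∀ x, K (fun s => f s + c * h s) x = K f x + c * K h x)
    (hsymm : ∀ ⦃f h : X → ℝ⦄, A f → A h →
      ∫ x, K f x * h x * w x ∂μ = ∫ x, f x * K h x * w x ∂μ)
    (hpos : ∀ ⦃f : X → ℝ⦄, A f → 0 ≤ ∫ x, f x * K f x * w x ∂μ)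
    {u : X → ℝ} (hu : A u) (k : ℕ) :
    ((∫ x, u x * K u x * w x ∂μ) / ∫ x, u x ^ 2 * w x ∂μ) ^ (k + 1)
      ≤ (∫ x, u x * (K^[k + 1] u) x * w x ∂μ) / ∫ x, u x ^ 2 * w x ∂μ := by
  have h := logConvex_ratio_pow_le (a := fun j => ∫ x, u x * (K^[j] u) x * w x ∂μ)
    (autocov_nonneg_of_pos hw0 hAK hsymm hpos hu)
    (autocov_logConvex_of_pos hw0 hAi hAc hAK hlin hsymm hpos hu) k
  simpa only [Function.iterate_one, Function.iterate_zero, id_eq, sq] using h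

/-- **Windows of a positive sampler are monotone in the cut-off** … -/
theorem tauIntWindow_mono_of_pos (hw0 : ∀ x, 0 ≤ w x)
    (hAK : ∀ ⦃f : X → ℝ⦄, A f → A (K f))
    (hsymm : ∀ ⦃f h : X → ℝ⦄, A f → A h →
      ∫ x, K f x * h x * w x ∂μ = ∫ x, f x * K h x * w x ∂μ)
    (hpos : ∀ ⦃f : X → ℝ⦄, A f → 0 ≤ ∫ x, f x * K f x * w x ∂μ)
    {u : X → ℝ} (hu : A u) :
    Monotone (tauIntWindow fun k => (∫ x, u x * (K^[k] u) x * w x ∂μ) / ∫ x, u x ^ 2 * w x ∂μ) :=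
  tauIntWindow_mono_of_nonneg fun k => autocorr_nonneg_of_pos hw0 hAK hsymm hpos hu (k + 1)

/-- **… and EVERY window under-estimates `τ_int`** (whenever the series is summable): for a positive
sampler the truncation bias of a windowed `τ_int` is one-signed, at every cut-off. -/
theorem tauIntWindow_le_tauInt_of_pos (hw0 : ∀ x, 0 ≤ w x)
    (hAK : ∀ ⦃f : X → ℝ⦄, A f → A (K f))
    (hsymm : ∀ ⦃f h : X → ℝ⦄, A f → A h →
      ∫ x, K f x * h x * w x ∂μ = ∫ x, f x * K h x * w x ∂μ)
    (hpos : ∀ ⦃f : X → ℝ⦄, A f → 0 ≤ ∫ x, f x * K f x * w x ∂μ)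
    {u : X → ℝ} (hu : A u)
    (hs : Summable fun k => (∫ x, u x * (K^[k + 1] u) x * w x ∂μ) / ∫ x, u x ^ 2 * w x ∂μ)
    (W : ℕ) :
    tauIntWindow (fun k => (∫ x, u x * (K^[k] u) x * w x ∂μ) / ∫ x, u x ^ 2 * w x ∂μ) W
      ≤ tauInt (fun k => (∫ x, u x * (K^[k] u) x * w x ∂μ) / ∫ x, u x ^ 2 * w x ∂μ) :=
  tauIntWindow_le_tauInt_of_nonneg (fun k => autocorr_nonneg_of_pos hw0 hAK hsymm hpos hu (k + 1))
    hs W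

/-- **A positive exact sampler is never better than independent sampling, for ANY observable**:
`½ ≤ ½ + ρ(1) ≤ τ_int` whenever the series is summable (no antithetic gain is possible). -/
theorem half_le_tauInt_of_pos (hw0 : ∀ x, 0 ≤ w x)
    (hAK : ∀ ⦃f : X → ℝ⦄, A f → A (K f))
    (hsymm : ∀ ⦃f h : X → ℝ⦄, A f → A h →
      ∫ x, K f x * h x * w x ∂μ = ∫ x, f x * K h x * w x ∂μ)
    (hpos : ∀ ⦃f : X → ℝ⦄, A f → 0 ≤ ∫ x, f x * K f x * w x ∂μ)
    {u : X → ℝ} (hu : A u)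
    (hs : Summable fun k => (∫ x, u x * (K^[k + 1] u) x * w x ∂μ) / ∫ x, u x ^ 2 * w x ∂μ) :
    1 / 2 ≤ 1 / 2 + (∫ x, u x * K u x * w x ∂μ) / (∫ x, u x ^ 2 * w x ∂μ) ∧
    1 / 2 + (∫ x, u x * K u x * w x ∂μ) / (∫ x, u x ^ 2 * w x ∂μ)
      ≤ tauInt (fun k => (∫ x, u x * (K^[k] u) x * w x ∂μ) / ∫ x, u x ^ 2 * w x ∂μ) := by
  have h1 := tauIntWindow_le_tauInt_of_pos hw0 hAK hsymm hpos hu hs 1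
  simp only [tauIntWindow, Finset.sum_range_one, Nat.zero_add, Function.iterate_one] at h1
  have h0 := autocorr_nonneg_of_pos hw0 hAK hsymm hpos hu 1
  simp only [Function.iterate_one] at h0
  exact ⟨by linarith, h1⟩

/-- **The geometric floor from summability alone**: for a positive sampler a summable
autocorrelation series forces `ρ(1) < 1`, and `τ_int ≥ (1 + ρ(1))/(2(1 − ρ(1)))`. -/
theorem tauInt_ge_geom_of_pos (hw0 : ∀ x, 0 ≤ w x)
    (hAi : ∀ ⦃f h : X → ℝ⦄, A f → A h → Integrable (fun x => f x * h x * w x) μ)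
    (hAc : ∀ ⦃f h : X → ℝ⦄ (c : ℝ), A f → A h → A (fun x => f x + c * h x))
    (hAK : ∀ ⦃f : X → ℝ⦄, A f → A (K f))
    (hlin : ∀ ⦃f h : X → ℝ⦄ (c : ℝ), A f → A h →
      ∀ x, K (fun s => f s + c * h s) x = K f x + c * K h x)
    (hsymm : ∀ ⦃f h : X → ℝ⦄, A f → A h →
      ∫ x, K f x * h x * w x ∂μ = ∫ x, f x * K h x * w x ∂μ)
    (hpos : ∀ ⦃f : X → ℝ⦄, A f → 0 ≤ ∫ x, f x * K f x * w x ∂μ)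
    {u : X → ℝ} (hu : A u)
    (hs : Summable fun k => (∫ x, u x * (K^[k + 1] u) x * w x ∂μ) / ∫ x, u x ^ 2 * w x ∂μ) :
    (∫ x, u x * K u x * w x ∂μ) / (∫ x, u x ^ 2 * w x ∂μ) < 1 ∧
    (1 + (∫ x, u x * K u x * w x ∂μ) / ∫ x, u x ^ 2 * w x ∂μ)
        / (2 * (1 - (∫ x, u x * K u x * w x ∂μ) / ∫ x, u x ^ 2 * w x ∂μ))
      ≤ tauInt (fun k => (∫ x, u x * (K^[k] u) x * w x ∂μ) / ∫ x, u x ^ 2 * w x ∂μ) := by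
  have h1 := autocorr_nonneg_of_pos hw0 hAK hsymm hpos hu 1
  have hpow := autocorr_pow_le_of_pos hw0 hAi hAc hAK hlin hsymm hpos hu
  simp only [Function.iterate_one] at h1
  have h := tauInt_ge_of_pow_le
    (ρ := fun k => (∫ x, u x * (K^[k] u) x * w x ∂μ) / ∫ x, u x ^ 2 * w x ∂μ)
    (by simpa only [Function.iterate_one] using h1)
    (fun k => by simpa only [Function.iterate_one] using hpow k) hs
  simpa only [Function.iterate_one] using h

/-- **Bounded windows force summability** (positive samplers only): if every window satisfies
`τ_W ≤ B` then the autocorrelation series is summable (and then `τ_W ↑ τ_int ≤ B`).  Equivalently: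
`τ_int = ∞` for a positive sampler means exactly that the windows grow without bound. -/
theorem summable_autocorr_of_windows_le (hw0 : ∀ x, 0 ≤ w x)
    (hAK : ∀ ⦃f : X → ℝ⦄, A f → A (K f))
    (hsymm : ∀ ⦃f h : X → ℝ⦄, A f → A h →
      ∫ x, K f x * h x * w x ∂μ = ∫ x, f x * K h x * w x ∂μ)
    (hpos : ∀ ⦃f : X → ℝ⦄, A f → 0 ≤ ∫ x, f x * K f x * w x ∂μ)
    {u : X → ℝ} (hu : A u) {B : ℝ}
    (hB : ∀ W, tauIntWindow (fun k => (∫ x, u x * (K^[k] u) x * w x ∂μ) / ∫ x, u x ^ 2 * w x ∂μ) W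
      ≤ B) :
    Summable fun k => (∫ x, u x * (K^[k + 1] u) x * w x ∂μ) / ∫ x, u x ^ 2 * w x ∂μ := by
  refine summable_of_sum_range_le (c := B - 1 / 2)
    (fun k => autocorr_nonneg_of_pos hw0 hAK hsymm hpos hu (k + 1)) fun W => ?_
  have h := hB W
  unfold tauIntWindow at h
  linarith

end RevOp

end Summit.Ventures.LatticeQCDFlow.Exactness
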